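/-
COR-CM (cell pub-hodgecm2, stage 2 of the Hodge ladder) — TRANSPOSITION SURGE (COORDINATOR RE-POINT 2026-08-21T12:07:17Z (2)(3),
`hodge-director/TRANSPOSITION-MAP.md` §0 v0–v3, seat ↔ item table): TYPED INTERFACE FOR DICTIONARY ITEM (i) «SETTING» of rfwf v3 §4.2.
Typer seat prover-pub-hodgecm2-tr-typer-1-0 (unit `pub-hodgecm2-tr-typer-1`), 2026-08-21; the prover queued behind it is
`pub-hodgecm2-tr-prover-1` (`Transposition/Item1SettingHolds.lean`, lead RULE (1) pre-ACK HOME/INBOX l.3654).  Definitions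
(`Prop`/`Type`-valued), one chosen term, projection lemmas and three by-name re-instantiations of TREE theorems; nothing cited as
a record, nothing asserted.  FRAMING (COORDINATOR 2026-08-21T11:55:35Z): `HC_CM` is NOT proved; this file proves no instance of a
period statement.

ITEM (i) = rfwf v3 §4.2 (i), `run/shared/lean/pub/pub-hodgecm/inputs/2001/summits__hodge-w-rank-four-weil-faces__free__y1__paper__paper.tex`
ll.230–234: «[PerL §§1.1–1.3] (fields, groups, surfaces, the statement): uses "L CM, Galois over ℚ, c central, L₀ totally real of degree
d ≥ 2"; here F, g ≥ 3.  [PerL §1.4] (inputs from [Y1neg]): by [Y1neg Thm 8.1(a) and its proof], §2 (input (R) = [DR Def 3.1, Thm 3.2],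
Rogawski's classification, stated over an arbitrary totally real field), Lemma 4.1, the first proof of Lemma 4.2, §§5–6 and Lemma 7.2
of [Y1neg] hold for G_U over any CM field of degree 2g ≥ 4; the Fock-model Lemmas 3.1, 3.2 of [Y1neg] are local.  General.»

TAG: **VERBATIM** — reason (one line): every OBJECT of PerL §§1.1–1.3 is typed in the tree over an arbitrary `L : CMField` with no
degree binder (`CMField` `CM/Basic.lean:67`, `HermSpace3 L ι₁` :182, `Level V` :225, `Universe.pms : (L : CMField) → … → Var`
`Geometry/Universe.lean:95`, `Universe.PeriodNV` `Geometry/Statements.lean:46`), and every setting FACT item (i) supplies is a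
degree-free (or `2 < [L:ℚ]`-guarded) tree theorem — admissible embeddings `StubTree.admissible_exists` (`StubTree/Combinatorics.lean:68`),
hermitian spaces of the wall's signatures `landherr_exists_proof` (`Proofs/Landherr.lean:47`), torsion-free congruence levels
`Level.nonempty` (`Geometry/NonVacuity.lean:97`), level coverings as morphisms of the universe of record lying over the
uniformisations `Model.exists_mor_pms_map_unif` (`B01/LevelCovering.lean:161`, BMM 2016 Intro §1.1 + Arapura Cor. 15.4.6
`arapura2012_cor_15_4_6_holds`); `6 ≤ [F:ℚ]` enters only through `Face.Admissible` (`CM/Basic.lean:133`) and the anisotropy guard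
`2 < [L:ℚ]` (`Model.isAnisotropic_pmsCode_of_two_lt`, `B01/LevelCovering.lean:90`).  The ONE statement left to the prover
(`LevelCofinal`: a torsion-free congruence level inside every open subgroup of `U(V₃,h)(𝔸_{L₀,f})`) is degree-free too
(Minkowski + `UnitaryGroup.exists_finCongruenceLevel_span_le_of_isOpen`).  Suppliers' tags concur: stage-1 lead
`hodge-director/TRANSPOSITION-STAGE1.md` §1 row (i) «VERBATIM — … typed over an arbitrary CM field and hermitian 3-space; nothing
to transpose»; stage-2 lead `TRANSPOSITION-MAP.md` §3 «(i) SETTING → no new field: the binders (F, f, ι₁, V), Level V, U.pms,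
U.Mor/cover/emb_cover — VERBATIM».  V-column: V-UNIFORM (everything below holds for every `V`; the `∃ V` of the re-typed target is
supplied here by `LandherrExists` and may be re-chosen by the V-sensitive items (iv)/(vi)).

STAGE-1 DECLARATIONS GENERALISED (package root `run/shared/lean/pub/pub-hodgecm/lean/HodgeCMPerL/HodgeCM/`):
* `Universe.RealisationExistsPerL` `StubTree/Inputs.lean:82–88` — prefix `(K L : CMField) (j) … finrank ℚ K = 6 … 24 ∨ 48 …
  ∀ (V : HermSpace3 L ι₁)` ↦ here `(F : CMField), [IsGalois ℚ F →] 6 ≤ finrank ℚ F → ∀ f : Face F, ∃ ι₁ admissible, ∃ V`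
  (= the prefix of `RealisationExistsFace` :97–100 in the ∃ form of RE-POINT (1) = lead's `Universe.FaceThetaDataExists`,
  `Transposition/Assembly.lean:52`, p271429): `Item1Setting.frame`.
* `Universe.ThetaRealisation.cover` `Automorphic/Realisation.lean:147` (`∀ Γ Γ', Γ'.Γ ≤ Γ.Γ → U.Mor (U.pms L ι₁ V Γ') (U.pms L ι₁ V Γ)`)
  and `.level_inf` :152 ↦ `LevelTower` below (the `K`-order `Γ' ≤ Γ` of the tree's `Level`, `CM/Basic.lean:271`; `level_inf` is the
  tree THEOREM `Level.exists_le_le` :312); model term `Model.coverOf (hA : Arapura2012_Cor_15_4_6)` `Model/CoverInstance.lean:168`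
  with `map_coverOf_unif` :176 ↦ `levelCover` / `map_levelCover_unif` below (`hA` discharged in the tree).
* `Universe.pms` `Geometry/Universe.lean:87`; `LandherrExists` `Geometry/Statements.lean:136` (`landherr_exists_proof`
  `Proofs/Landherr.lean:96`); `AdmissibleExists` :144 (`StubTree.admissible_exists` `StubTree/Combinatorics.lean:62`); `PmsDimTwo` :139
  (`ModelAxioms.pms_dim` `Geometry/Facts.lean:280`); `Level.nonempty` `Model/ToyG2/LevelExists.lean` — tree twins
  `CorCM/Geometry/{Universe,Statements,NonVacuity}.lean`, `CorCM/Proofs/Landherr.lean`.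
* E term «UARM» `Model/E2InstanceOGR21AEPISTR2DJWHHTCGUARM.lean:59`: the two SETTING binder groups of «U», `hA := arapura2012_cor_15_4_6_holds`
  (level coverings algebraic) and `hR := deligneMilne1982_Thm_6_20_full_holds`, are discharged there and in the tree — no setting
  binder survives to the face case.
-/
import Summits.HodgeConjecture.CorCM.B01.ThetaRealisationSocket
import Summits.HodgeConjecture.CorCM.B01.LevelCovering
import Summits.HodgeConjecture.CorCM.Geometry.NonVacuity
import HarnessLib

/-!
# Transposition, item (i): the SETTING — fields, groups, surfaces, levels, level coverings (typed interface)

What item (i) must supply toward `RealisationExistsFace∃` (socket form `Universe.FaceThetaDataExists U :=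
∀ F, IsGalois ℚ F → 6 ≤ [F:ℚ] → ∀ f : Face F, ∃ ι₁, f.Admissible ι₁ ∧ ∃ V, Nonempty (U.FaceThetaDatum ι₁ V F f.psi ι₁)`,
socket `B01/ThetaRealisationSocket.lean:66–97`), with the quantifiers PerL delivers (RE-POINT (1): one `ι₁`, one `V` per face):

* (a)(b) FIELDS AND GROUPS — the quantifier prefix `∃ ι₁ admissible, ∃ V`: `Item1Setting.frame` = `Universe.AdmissibleExists ∧
  Universe.LandherrExists` (`Geometry/Statements.lean:159/:151`; rfwf Lemma 2.1 / PerL Thm 4.4 proof, tex l.691 «take h = ⟨1,1,a⟩ …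
  weak approximation in L₀»).  Both are TREE THEOREMS; `F₀ = maximalRealSubfield F` (Mathlib), `G_U(𝔸_{F₀,f}) = V.adelicFin`
  (`CM/Basic.lean:202`), «c central» = Mathlib `NumberField.IsCMField.complexEmbedding_complexConj` (used by item (ii), not here).
* (c) SURFACES AND LEVELS — `U.pms F ι₁ V Γ` for every torsion-free congruence level `Γ : Level V` (PerL §1.2 «for torsion-free Γ,
  P_Γ := Γ\𝔹² is a smooth projective surface»; [Y1neg] §1.1 / Lemma 7.2 «a neat normal K₁ ⊂ K_f of finite index with P_{Γ₁} → P_Γ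
  finite étale»): `LevelCofinal` (a level inside every open subgroup of `G_U(𝔸_{F₀,f})` — what the constructor of the theta one-form
  sets `Theta i Γ` of item (vi) needs to descend a `K`-invariant theta function to a class on `P_Γ`; THE ONE OPEN OBLIGATION of this
  item, degree-free), and the socket field `cover` (:88): its TYPE `LevelTower U ι₁ V`, and on the universe of record the CHOSEN
  level coverings `levelCover` with their junction over the ball uniformisations `map_levelCover_unif` — the property item (iii)
  consumes to prove the socket field `emb_cover` (:90) for ITS `emb`, and from which `UnitaryBallLevelFiniteCover.isFiniteCover_of_unif_comp`
  gives [Y1neg] Lemma 7.2's «finite étale».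
* (d) THE STATEMENT — nothing to type: `Universe.PeriodNV` / `PeriodThmF` (`Geometry/Statements.lean:46/:85`) and the ∃-witness form
  (`FacePeriodWitnesses.lean:189 hc_cm_closed_of_exists_facePeriod`) are in the tree.
* (e) THE [Y1neg] INPUTS «valid over any CM field of degree ≥ 4» are consumed INSIDE other items' socket fields and are typed there,
  degree-free: Thm 8.1(a) / Prop 6.2 (theta one-forms are `A_Ψ`-isotypic `ι₁`-eigen) = `Theta_sub` (:77, items (ii)/(vi); print anchor
  [Liu 2021 Thm 4.18] general in the degree — TRANSPOSITION-MAP §0-v2 answer (ii)); Matsushima / [DR] input (R) = `emb`, `inner_emb`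
  (:73/:93, item (iii)); Lemma 7.2 = `cover` here + `UnitaryBallLevelFiniteCover`; Fock-model Lemmas 3.1/3.2 = local, items (iv)/(vi).
  No declaration of this file mentions them.

QUANTIFIER AUDIT: `Item1Setting` is universe-free and V-uniform (`∀ V`); the model-side `levelCover` is a term for every
`(L, 2 < [L:ℚ], ι₁, V, Γ' ≤ Γ)`; no `∀ V` is passed downstream as a hypothesis — the ∃ of `FaceThetaDataExists` is met by
`exists_faceThetaDatum_of_forall` (any `V`, Landherr) or by the V-sensitive items' own choice.

Projection lemmas: `Item1Setting.admissibleExists/landherrExists` (and `.2.2 : LevelCofinal`), `item1Setting_of_levelCofinal` (the two proved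
conjuncts by name), `levelCofinal_le` (relative form: a level below a given one inside a given open subgroup),
`exists_faceThetaDatum_of_forall` (item (i)'s prefix turns theta data given at EVERY admissible `(ι₁, V)` into the ∃ form =
`Universe.FaceThetaDataExists U`, `Transposition/Assembly.lean:52`, unfolded).

References: PerL v5 (blob d912a121) §§1.1–1.4, Thm 4.4; rfwf v3 (a9f5cf86) §4.2 (i); N. Bergeron, J. Millson, C. Moeglin, Acta Math.
216 (2016), Introduction §1.1; D. Arapura, *Algebraic Geometry over the Complex Numbers* (2012) Cor. 15.4.6; W. Landherr, Abh. Math.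
Sem. Hamburg 11 (1936); H. Minkowski (1887) (torsion-freeness of `Γ(n)`, `n ≥ 3`); V. Platonov, A. Rapinchuk, *Algebraic Groups and
Number Theory* (1994) §4.1/§5.1.
-/

noncomputable section

namespace Summit.HodgeConjecture.CorCM

namespace Transposition

open Literature.AlgebraicGeometry.Motives
open Literature.AlgebraicGeometry.ShimuraVarieties
open Literature.AlgebraicGeometry.HodgeTheory
open Literature.NumberTheory.Automorphic
open Literature.NumberTheory.Automorphic.PicardCM

/-! ### (c) Levels: a torsion-free congruence level inside every open subgroup — the one open obligation of item (i) -/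

/-- **Item (i)(c), deep levels** (PerL v5 §1.2 «for a compact open K_f … for neat K_f these are smooth projective surfaces»;
[Y1neg] §1.1 / Lemma 7.2): for every hermitian 3-space `(V₃,h)` over a CM field `L` and every OPEN subgroup `K'` of
`U(V₃,h)(𝔸_{L₀,f})` (`V.adelicFin`, `CM/Basic.lean:202`) there is a torsion-free congruence level `Γ : Level V` with compact open
`Γ.K ≤ K'`.  Degree-free.  Route for the prover (all tree): `UnitaryGroup.exists_finCongruenceLevel_span_le_of_isOpen`
(`K_f(n𝓞_L) ≤ K'`), the principal level `(Γ(3), K_f(3𝓞_L))` of `Level.exists_Γ_eq_principalCongruenceSubgroup`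
(`Geometry/NonVacuity.lean:73`, Minkowski), and the pair `(U(L₀) ∩ (K_f(n) ⊓ K_f(3)), K_f(n) ⊓ K_f(3))`
(`UnitaryGroup.arithmeticLevel_inf`; torsion-free as a subgroup of `Γ(3)`).  Consumed by the constructor of the theta one-form sets
`Theta i Γ` (item (vi)): a `K'`-invariant theta function descends to a class on `P_Γ` once `Γ.K ≤ K'`.  Displayed hypothesis
(prover `pub-hodgecm2-tr-prover-1` lands `levelCofinal_holds`); not asserted. [folklore] -/
@[conjecture]
def LevelCofinal : Prop :=
  ∀ {L : CMField} {ι₁ : L →+* ℂ} (V : HermSpace3 L ι₁) (K' : Subgroup V.adelicFin),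
    IsOpen (K' : Set V.adelicFin) → ∃ Γ : Level V, Γ.K ≤ K'

/-- Relative form of `LevelCofinal`: below any level `Γ` and inside any open `K'` there is a level (the meet with a level inside
`K'`; levels are a meet-semilattice for the `K`-order, `Level.instSemilatticeInf`, `CM/Basic.lean:294`). [folklore] -/
theorem levelCofinal_le (h : LevelCofinal) {L : CMField} {ι₁ : L →+* ℂ} {V : HermSpace3 L ι₁} (Γ : Level V)
    (K' : Subgroup V.adelicFin) (hK' : IsOpen (K' : Set V.adelicFin)) :
    ∃ Γ' : Level V, Γ' ≤ Γ ∧ Γ'.K ≤ K' := by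
  obtain ⟨Γ₀, h₀⟩ := h V K' hK'
  exact ⟨Γ ⊓ Γ₀, inf_le_left, le_trans (inf_le_right : Γ.K ⊓ Γ₀.K ≤ Γ₀.K) h₀⟩

/-! ### The typed axiom of item (i) (universe-free part) and its projections -/

/-- **ITEM (i) — SETTING, the typed axiom (universe-free, V-uniform).**  (a)(b) every rank-four face of a CM field of degree `≥ 6`
has an admissible embedding `ι₁` (`Universe.AdmissibleExists`, `Geometry/Statements.lean:159`; rfwf Lemma 2.1) and every
`(L, ι₁)` carries a hermitian 3-space of signature `(2,1)` at `ι₁`, `(3,0)` elsewhere (`Universe.LandherrExists` :151; PerL Thm 4.4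
proof, tex l.691, weak approximation) — together the `∃ ι₁ … ∃ V` prefix of `FaceThetaDataExists`; (c) deep torsion-free
congruence levels (`LevelCofinal`).  The first two conjuncts are tree theorems (`item1Setting_of_levelCofinal`); the model-side
supply of item (i) — the level coverings — is the TERM `levelCover` below, not a hypothesis.  Displayed hypothesis of the
transposition assembly; not asserted. [folklore] -/
@[conjecture]
def Item1Setting : Prop :=
  Universe.AdmissibleExists ∧ Universe.LandherrExists ∧ LevelCofinal

namespace Item1Setting

/-- Projection (a): admissible embeddings exist. [folklore] -/
theorem admissibleExists (h : Item1Setting) : Universe.AdmissibleExists := h.1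

/-- Projection (b): hermitian 3-spaces of the wall's signatures exist. [folklore] -/
theorem landherrExists (h : Item1Setting) : Universe.LandherrExists := h.2.1

/-- Projection (a)(b) in the shape of the `FaceThetaDataExists` prefix: per face, an admissible `ι₁` and a `V` (and `Level V` is
then inhabited, `Level.nonempty`, `Geometry/NonVacuity.lean:97`). [folklore] -/
theorem frame (h : Item1Setting) (F : CMField) (h6 : 6 ≤ Module.finrank ℚ F) (f : Face F) :
    ∃ ι₁ : F →+* ℂ, f.Admissible ι₁ ∧ ∃ V : HermSpace3 F ι₁, Nonempty (Level V) := by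
  obtain ⟨ι₁, hι⟩ := h.admissibleExists F h6 f
  obtain ⟨V⟩ := h.landherrExists F ι₁
  exact ⟨ι₁, hι, V, Level.nonempty V⟩

end Item1Setting

/-- **Conjuncts (a)(b) are tree theorems** (`StubTree.admissible_exists`, `StubTree/Combinatorics.lean:68`; `landherr_exists_proof`,
`Proofs/Landherr.lean:47`): item (i) reduces BY NAME to `LevelCofinal`. [folklore] -/
theorem item1Setting_of_levelCofinal (h : LevelCofinal) : Item1Setting :=
  ⟨StubTree.admissible_exists, landherr_exists_proof, h⟩

/-! ### (c) Level coverings: the socket field `cover`, its type, and the chosen term on the universe of record -/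

/-- The TYPE of the socket field `FaceThetaDatum.cover` (`B01/ThetaRealisationSocket.lean:88`): a morphism `P_{Γ'} → P_Γ` of the
universe for every pair of levels `Γ' ≤ Γ` (`K`-order, `Level.le_def`, `CM/Basic.lean:274`).  Stage 1:
`ThetaRealisation.cover` (`Automorphic/Realisation.lean:147`, `GL₃`-order `Γ'.Γ ≤ Γ.Γ`; `Level.Γ_mono` converts). [folklore] -/
abbrev LevelTower (U : Universe) {L : CMField} (ι₁ : L →+* ℂ) (V : HermSpace3 L ι₁) : Type :=
  ∀ Γ Γ' : Level V, Γ' ≤ Γ → U.Mor (U.pms L ι₁ V Γ') (U.pms L ι₁ V Γ)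

section Model

open Model

/- Binders of the universe of record, written out on every declaration (no `variable`): `hHD hI` = the two Hodge-model facts,
`h₁` = `BallQuotientUniformised`, `h₃` = `CMAbelianVarietyRealised` — all four are TREE THEOREMS (`exists_isReal_hodgeModel_holds`,
`hodgePQ_independent_of_hodgeModel_holds`, `BallQuotient.ballQuotientUniformised_holds`, `cmAbelianVarietyRealised_holds`), kept as
parameters exactly as in `Model.picardCMUniverse` so that the terms below apply to every instance of the universe of record. -/

/-- The ball uniformisation datum `Γ\𝔹² ≅ P_Γ(ℂ)` of the realising surface of the universe of record
`U = Model.picardCMUniverse hHD hI h₁ h₃` (`Model/Universe.lean:166`; `U.pms L ι₁ V Γ = .pms (pmsCode L ι₁ V Γ)` and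
`U.Mor = scheme morphisms`, both `rfl`), in the anisotropic regime `2 < [L:ℚ]` (`Model.isAnisotropic_pmsCode_of_two_lt`,
`B01/LevelCovering.lean:90`; every face context has `6 ≤ [F:ℚ]`).  An abbreviation of `PicardCM.Var.ballDatum` at the code
`Model.pmsCode L ι₁ V Γ`, for readable statements below. [folklore] -/
abbrev ballDatumRec (h₁ : BallQuotientUniformised) (h₃ : CMAbelianVarietyRealised) {L : CMField} (hL : 2 < Module.finrank ℚ L) {ι₁ : L →+* ℂ} {V : HermSpace3 L ι₁} (Γ : Level V) :
    UnitaryBallUniformisationDatum 2 (Var.scheme (ballQuotientUniformisedDatum_of h₁) h₃ (.pms (pmsCode L ι₁ V Γ))) :=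
  Var.ballDatum (ballQuotientUniformisedDatum_of h₁) h₃ (pmsCode L ι₁ V Γ) (isAnisotropic_pmsCode_of_two_lt hL Γ)

/-- **Level coverings exist on the universe of record** for `Γ' ≤ Γ` and `2 < [L:ℚ]`: a morphism `g : P_{Γ'} → P_Γ` of
`U = Model.picardCMUniverse hHD hI h₁ h₃` with `g(ℂ) ∘ unif_{Γ'} = unif_Γ` on the negative cone — BY NAME the tree theorem
`Model.exists_mor_pms_map_unif` (`B01/LevelCovering.lean:161`; holomorphic by `UnitaryBallLevelCovering`, algebraic by
`arapura2012_cor_15_4_6_holds`), read in the `K`-order through `Level.Γ_mono` (`CM/Basic.lean:278`).  The junction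
`AlgPoints.map g (D'.unif v) = D.unif v` is exactly the hypothesis of the tree files `UnitaryBallLevelFiniteCover` (finite
covering, transfer: [Y1neg] Lemma 7.2 «finite étale») and `UnitaryBallThetaClassLevelChange` (theta classes pull back to theta
classes), i.e. what item (iii) needs of `cover` to prove the socket field `emb_cover`.
[cite: BergeronMillsonMoeglin2016Balls, Introduction §1.1] -/
theorem exists_levelCover_map_unif (hHD : exists_isReal_hodgeModel) (hI : hodgePQ_independent_of_hodgeModel)
    (h₁ : BallQuotientUniformised) (h₃ : CMAbelianVarietyRealised)
    {L : CMField} (hL : 2 < Module.finrank ℚ L) {ι₁ : L →+* ℂ} {V : HermSpace3 L ι₁}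
    (Γ Γ' : Level V) (hle : Γ' ≤ Γ) :
    ∃ g : (picardCMUniverse hHD hI h₁ h₃).Mor ((picardCMUniverse hHD hI h₁ h₃).pms L ι₁ V Γ')
        ((picardCMUniverse hHD hI h₁ h₃).pms L ι₁ V Γ),
      ∀ v ∈ (ballDatumRec h₁ h₃ hL Γ').cone,
        AlgPoints.map g ((ballDatumRec h₁ h₃ hL Γ').unif v) = (ballDatumRec h₁ h₃ hL Γ).unif v :=
  exists_mor_pms_map_unif hHD hI h₁ h₃ (Level.Γ_mono hle) (isAnisotropic_pmsCode_of_two_lt hL Γ)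

/-- **Item (i)(c), the chosen level covering** `P_{Γ'} → P_Γ` of the universe of record (`Γ' ≤ Γ`, `2 < [L:ℚ]`): the term the
socket field `cover` is filled with (stage 1: `Model.coverOf`, `Model/CoverInstance.lean:168`).
[cite: BergeronMillsonMoeglin2016Balls, Introduction §1.1] -/
def levelCover (hHD : exists_isReal_hodgeModel) (hI : hodgePQ_independent_of_hodgeModel)
    (h₁ : BallQuotientUniformised) (h₃ : CMAbelianVarietyRealised)
    {L : CMField} (hL : 2 < Module.finrank ℚ L) {ι₁ : L →+* ℂ} {V : HermSpace3 L ι₁} (Γ Γ' : Level V)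
    (hle : Γ' ≤ Γ) :
    (picardCMUniverse hHD hI h₁ h₃).Mor ((picardCMUniverse hHD hI h₁ h₃).pms L ι₁ V Γ')
      ((picardCMUniverse hHD hI h₁ h₃).pms L ι₁ V Γ) :=
  (exists_levelCover_map_unif hHD hI h₁ h₃ hL Γ Γ' hle).choose

/-- The chosen level covering lies over the uniformisations: `levelCover(ℂ) ∘ unif_{Γ'} = unif_Γ` on the negative cone
(stage 1: `Model.map_coverOf_unif`, `Model/CoverInstance.lean:176`). [cite: BergeronMillsonMoeglin2016Balls, Introduction §1.1] -/
theorem map_levelCover_unif (hHD : exists_isReal_hodgeModel) (hI : hodgePQ_independent_of_hodgeModel)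
    (h₁ : BallQuotientUniformised) (h₃ : CMAbelianVarietyRealised)
    {L : CMField} (hL : 2 < Module.finrank ℚ L) {ι₁ : L →+* ℂ} {V : HermSpace3 L ι₁}
    (Γ Γ' : Level V) (hle : Γ' ≤ Γ) :
    ∀ v ∈ (ballDatumRec h₁ h₃ hL Γ').cone,
      AlgPoints.map (levelCover hHD hI h₁ h₃ hL Γ Γ' hle) ((ballDatumRec h₁ h₃ hL Γ').unif v) =
        (ballDatumRec h₁ h₃ hL Γ).unif v :=
  (exists_levelCover_map_unif hHD hI h₁ h₃ hL Γ Γ' hle).choose_spec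

/-- **The socket field `cover` on the universe of record**, for every CM field of degree `> 2` (every face context has
`6 ≤ [F:ℚ]`), every `ι₁` and EVERY hermitian 3-space `V` (V-uniform). [folklore] -/
def levelTowerRec (hHD : exists_isReal_hodgeModel) (hI : hodgePQ_independent_of_hodgeModel)
    (h₁ : BallQuotientUniformised) (h₃ : CMAbelianVarietyRealised)
    {L : CMField} (hL : 2 < Module.finrank ℚ L) (ι₁ : L →+* ℂ) (V : HermSpace3 L ι₁) :
    LevelTower (picardCMUniverse hHD hI h₁ h₃) ι₁ V :=
  fun Γ Γ' hle => levelCover hHD hI h₁ h₃ hL Γ Γ' hle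

/-- Every face context is in the anisotropic regime: `6 ≤ [F:ℚ]` gives `2 < [F:ℚ]` (the guard of `levelCover`). [folklore] -/
theorem two_lt_finrank_of_six_le {F : CMField} (h6 : 6 ≤ Module.finrank ℚ F) : 2 < Module.finrank ℚ F :=
  lt_of_lt_of_le (by norm_num) h6

end Model

/-! ### Projection to the ∃ form of the re-typed target -/

/-- **Item (i)'s prefix turns V-uniform theta data into the ∃ form.**  If face theta data are given at EVERY admissible `ι₁` and
EVERY `V` (the `∀` shape of `B01/ThetaRealisationSocket.lean:164 periodThmF_of_faceThetaData`, which the V-uniform items may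
deliver), item (i) supplies the witnesses `ι₁` (admissible) and `V` (Landherr), giving the ∃ form.  The conclusion is LITERALLY
`Universe.FaceThetaDataExists U` of the lead's day-1 assembly (`Transposition/Assembly.lean:52`, p271429 ✔; its
`faceThetaDataExists_of_forall` :70 takes exactly item (i)'s `hadm`, `hV`), UNFOLDED here (`Iff.rfl`) so that this file does not
import a module whose farm olean postdates it; the by-name form is a one-line corollary for `Item1SettingHolds.lean`.  The
V-sensitive items (iv)/(vi) may instead choose their own `V`; then this lemma is not on the path. [folklore] -/
theorem exists_faceThetaDatum_of_forall {U : Universe} (h : Item1Setting)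
    (hR : ∀ (F : CMField), IsGalois ℚ F → 6 ≤ Module.finrank ℚ F → ∀ (f : Face F) (ι₁ : F →+* ℂ), f.Admissible ι₁ →
      ∀ V : HermSpace3 F ι₁, Nonempty (U.FaceThetaDatum ι₁ V F f.psi ι₁)) :
    ∀ (F : CMField), IsGalois ℚ F → 6 ≤ Module.finrank ℚ F → ∀ f : Face F,
      ∃ ι₁ : F →+* ℂ, f.Admissible ι₁ ∧ ∃ V : HermSpace3 F ι₁, Nonempty (U.FaceThetaDatum ι₁ V F f.psi ι₁) := by
  intro F hG h6 f
  obtain ⟨ι₁, hι, V, -⟩ := h.frame F h6 f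
  exact ⟨ι₁, hι, V, hR F hG h6 f ι₁ hι V⟩

end Transposition

end Summit.HodgeConjecture.CorCM

end
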